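import Mathlib

/-!
# Loop erasure with a stopping rule: a simple cycle out of a closed shadowing walk

Support file for `RectilinearSuffices` (route CardyBoundaryCoulombGas of `CardyFormulaZ2`,
item stmt-CriticalPhenomena-5663): the combinatorial core of the rectilinear approximation of a
Jordan curve. We are given a *closed walk* `w` on an abstract vertex type `V` with an adjacency
relation `adj`, each vertex carrying a real *parameter* (think: `w` shadows a Jordan loop `β`,
the vertex `(v, σ)` being close to `β σ`), such that

* consecutive parameters increase by less than `L` and consecutive vertices are equal or adjacent;
* (bottleneck) two entries with the SAME vertex have parameters at circular distance `< L`
  (either `|σ - σ'| < L` or `|σ - σ'| > 1 - L`);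
* the walk returns to its initial vertex with a parameter exceeding the initial one by `> 1/2`.

Chronological loop erasure, run along `w` but *stopped* the first time the current vertex closes a
loop of parameter length `> 1/2` (hence `> 1 - L`), produces a **simple cycle** whose consecutive
parameters increase by `< 2L`, which closes up with a parameter defect `< 3L`, starts at parameter
`< L` and ends at parameter `> 1 - 3L` (`exists_cycle_of_walk`). The proof is the induction behind
the algorithm (no function is defined): the current simple path `p` is either extended, cut back
to the earlier occurrence of the new vertex, or output from that occurrence on.
-/

namespace Summit.CriticalPhenomena.CardyFormulaZ2.Theorems

open Set

variable {V : Type*}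

/-- Parameters increase along a path whose consecutive parameters increase. [folklore] -/
theorem param_mono_of_chain {p : List (V × ℝ)}
    (hchain : ∀ (i : ℕ) (hi : i + 1 < p.length), (p[i]).2 < (p[i + 1]).2) {i j : ℕ}
    (hij : i ≤ j) (hj : j < p.length) : (p[i]'(lt_of_le_of_lt hij hj)).2 ≤ (p[j]).2 := by
  induction j with
  | zero =>
    have : i = 0 := Nat.le_zero.1 hij
    subst this; exact le_rfl
  | succ j ih =>
    rcases Nat.lt_or_ge i (j + 1) with h | h
    · have hj' : j < p.length := by omega
      exact (ih (Nat.lt_succ_iff.1 h) hj').trans (hchain j hj).le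
    · have : i = j + 1 := le_antisymm hij h
      subst this; exact le_rfl

/-- **Loop erasure with a stopping rule.** See the module docstring. The current simple path is
`p` (nonempty, pairwise distinct vertices, consecutive vertices adjacent with parameters
increasing by `< 2L`), the remaining walk is `w` (consecutive entries equal-or-adjacent with
parameters increasing by `< L`, linked to the end of `p` likewise with `2L`), the bottleneck and
range hypotheses hold on `p ++ w`, and `w` ends at the initial vertex of `p` with a parameter
larger by `> 1/2`. Then some sub-collection of `p ++ w` forms a simple cycle with the stated
parameter control. [folklore] -/
theorem exists_cycle_of_walk (adj : V → V → Prop) {L : ℝ} (hL : 0 < L) (hL8 : L ≤ 1 / 8)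
    (w : List (V × ℝ)) :
    ∀ (p : List (V × ℝ)) (hp : p ≠ []),
    (∀ (i j : ℕ) (hi : i < p.length) (hj : j < p.length), (p[i]).1 = (p[j]).1 → i = j) →
    (∀ (i : ℕ) (hi : i + 1 < p.length), adj (p[i]).1 (p[i + 1]).1 ∧ (p[i]).2 < (p[i + 1]).2 ∧
      (p[i + 1]).2 - (p[i]).2 < 2 * L) →
    (∀ (i : ℕ) (hi : i + 1 < w.length), ((w[i]).1 = (w[i + 1]).1 ∨ adj (w[i]).1 (w[i + 1]).1) ∧
      (w[i]).2 < (w[i + 1]).2 ∧ (w[i + 1]).2 - (w[i]).2 < L) →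
    (∀ (h0 : 0 < w.length), ((p.getLast hp).1 = (w[0]).1 ∨ adj (p.getLast hp).1 (w[0]).1) ∧
      (p.getLast hp).2 < (w[0]).2 ∧ (w[0]).2 - (p.getLast hp).2 < 2 * L) →
    (∀ x ∈ p ++ w, ∀ y ∈ p ++ w, x.1 = y.1 → |y.2 - x.2| < L ∨ 1 - L < |y.2 - x.2|) →
    (∀ x ∈ p ++ w, 0 ≤ x.2 ∧ x.2 ≤ 1) →
    (∃ hw0 : w ≠ [], (w.getLast hw0).1 = (p.head hp).1 ∧ (p.head hp).2 + 1 / 2 < (w.getLast hw0).2) →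
    ∃ q : List (V × ℝ), ∃ hq : q ≠ [], (∀ x ∈ q, x ∈ p ++ w) ∧
      (∀ (i j : ℕ) (hi : i < q.length) (hj : j < q.length), (q[i]).1 = (q[j]).1 → i = j) ∧
      (∀ (i : ℕ) (hi : i + 1 < q.length), adj (q[i]).1 (q[i + 1]).1 ∧ (q[i]).2 < (q[i + 1]).2 ∧
        (q[i + 1]).2 - (q[i]).2 < 2 * L) ∧
      adj (q.getLast hq).1 (q.head hq).1 ∧ (q.getLast hq).2 < (q.head hq).2 + 1 ∧
      (q.head hq).2 + 1 - (q.getLast hq).2 < 3 * L ∧ (q.head hq).2 < L ∧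
      1 - 3 * L < (q.getLast hq).2 := by
  induction w with
  | nil =>
    intro p hp _ _ _ _ _ _ hend
    obtain ⟨hw0, -⟩ := hend
    exact absurd rfl hw0
  | cons a rest ih =>
    intro p hp hnodup hchain hw hlink hbottle hrange hend
    have hlen : 0 < p.length := List.length_pos_iff.2 hp
    have hlast : p.getLast hp = p[p.length - 1] := List.getLast_eq_getElem hp
    have hhead : p.head hp = p[0] := List.head_eq_getElem hp
    obtain ⟨hl1, hl2, hl3⟩ := hlink (by simp)
    simp only [List.getElem_cons_zero] at hl1 hl2 hl3
    rw [hlast] at hl1 hl2 hl3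
    obtain ⟨_, hend1, hend2⟩ := id hend
    rw [hhead] at hend1 hend2
    -- all parameters of `p` are below that of `a`
    have hmono : ∀ (i : ℕ) (hi : i < p.length), (p[i]).2 ≤ (p[p.length - 1]).2 := fun i hi =>
      param_mono_of_chain (fun k hk => (hchain k hk).2.1) (by omega) (by omega)
    have hlt_a : ∀ (i : ℕ) (hi : i < p.length), (p[i]).2 < a.2 := fun i hi => by
      have := hmono i hi; linarith
    have ha_mem : a ∈ p ++ a :: rest := List.mem_append_right _ List.mem_cons_self
    have hp_mem : ∀ (i : ℕ) (hi : i < p.length), p[i] ∈ p ++ a :: rest := fun i hi =>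
      List.mem_append_left _ (List.getElem_mem hi)
    have ha1 : a.2 ≤ 1 := (hrange a ha_mem).2
    -- the walk shifted by one
    have hw' : ∀ (i : ℕ) (hi : i + 1 < rest.length), ((rest[i]).1 = (rest[i + 1]).1 ∨
        adj (rest[i]).1 (rest[i + 1]).1) ∧ (rest[i]).2 < (rest[i + 1]).2 ∧
        (rest[i + 1]).2 - (rest[i]).2 < L := fun i hi => by
      have := hw (i + 1) (by simp; omega)
      simpa using this
    have hw0 : ∀ (h0 : 0 < rest.length), (a.1 = (rest[0]).1 ∨ adj a.1 (rest[0]).1) ∧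
        a.2 < (rest[0]).2 ∧ (rest[0]).2 - a.2 < L := fun h0 => by
      have := hw 0 (by simp; omega)
      simpa using this
    -- membership transfers
    have hmem_take : ∀ (n : ℕ), ∀ x ∈ p.take n ++ rest, x ∈ p ++ a :: rest := fun n x hx => by
      rcases List.mem_append.1 hx with h | h
      · exact List.mem_append_left _ (List.take_subset _ _ h)
      · exact List.mem_append_right _ (List.mem_cons_of_mem _ h)
    have hmem_app : ∀ x ∈ (p ++ [a]) ++ rest, x ∈ p ++ a :: rest := fun x hx => by
      rw [List.append_assoc, List.singleton_append] at hx; exact hx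
    by_cases hex : ∃ (i : ℕ) (hi : i < p.length), (p[i]).1 = a.1
    · obtain ⟨i, hi, hia⟩ := hex
      have hpos : 0 < a.2 - (p[i]).2 := by linarith [hlt_a i hi]
      have hbot := hbottle (p[i]) (hp_mem i hi) a ha_mem hia
      rw [abs_of_pos hpos] at hbot
      by_cases hcut : a.2 - (p[i]).2 ≤ 1 / 2
      · -- CUT back to the earlier occurrence
        have hsmall : a.2 - (p[i]).2 < L := by
          rcases hbot with h | h
          · exact h
          · linarith
        have hlenT : (p.take (i + 1)).length = i + 1 := by rw [List.length_take]; omega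
        have hTne : p.take (i + 1) ≠ [] := List.ne_nil_of_length_pos (by rw [hlenT]; omega)
        have hgetT : ∀ (k : ℕ) (hk : k < (p.take (i + 1)).length),
            (p.take (i + 1))[k] = p[k]'(by rw [hlenT] at hk; omega) :=
          fun k hk => List.getElem_take
        have hlastT : (p.take (i + 1)).getLast hTne = p[i] := by
          rw [List.getLast_eq_getElem]
          simp only [List.getElem_take, List.length_take, Nat.min_eq_left (show i + 1 ≤ p.length by omega),
            Nat.add_sub_cancel]
        have hheadT : (p.take (i + 1)).head hTne = p[0] := by
          rw [List.head_eq_getElem, List.getElem_take]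
        -- `rest` is nonempty: otherwise `a` closes the long loop
        have hrest : rest ≠ [] := by
          intro hr
          subst hr
          simp only [List.getLast_singleton] at hend1 hend2
          have : i = 0 := hnodup i 0 hi hlen (hia.trans hend1)
          subst this
          linarith
        obtain ⟨q, hq, hsub, h1, h2, h3⟩ := ih (p.take (i + 1)) hTne
          (fun k j hk hj h => by
            rw [hgetT k hk, hgetT j hj] at h
            exact hnodup k j _ _ h)
          (fun k hk => by
            rw [hgetT k (by omega), hgetT (k + 1) hk]
            exact hchain k (by rw [hlenT] at hk; omega))
          hw'
          (fun h0 => by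
            rw [hlastT]
            obtain ⟨h01, h02, h03⟩ := hw0 h0
            rw [← hia] at h01
            exact ⟨h01, by linarith [hlt_a i hi], by linarith⟩)
          (fun x hx y hy hxy => hbottle x (hmem_take _ x hx) y (hmem_take _ y hy) hxy)
          (fun x hx => hrange x (hmem_take _ x hx))
          (by
            refine ⟨hrest, ?_, ?_⟩
            · rw [List.getLast_cons hrest] at hend1
              rw [hheadT]; exact hend1
            · rw [List.getLast_cons hrest] at hend2
              rw [hheadT]; exact hend2)
        exact ⟨q, hq, fun x hx => hmem_take _ x (hsub x hx), h1, h2, h3⟩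
      · -- EXIT: output the path from the earlier occurrence on
        push Not at hcut
        have hbig : 1 - L < a.2 - (p[i]).2 := by
          rcases hbot with h | h
          · linarith
          · exact h
        have hlenD : (p.drop i).length = p.length - i := by rw [List.length_drop]
        have hDne : p.drop i ≠ [] := List.ne_nil_of_length_pos (by rw [hlenD]; omega)
        have hgetD : ∀ (k : ℕ) (hk : k < (p.drop i).length),
            (p.drop i)[k] = p[i + k]'(by rw [hlenD] at hk; omega) :=
          fun k hk => List.getElem_drop
        have hheadD : (p.drop i).head hDne = p[i] := by
          rw [List.head_eq_getElem, List.getElem_drop]; simp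
        have hlastD : (p.drop i).getLast hDne = p[p.length - 1] := by
          rw [List.getLast_eq_getElem]
          simp only [List.getElem_drop, List.length_drop]
          congr 1; omega
        have h0i : 0 ≤ (p[i]).2 := (hrange _ (hp_mem i hi)).1
        have hlt_last := hlt_a (p.length - 1) (by omega)
        refine ⟨p.drop i, hDne, fun x hx => List.mem_append_left _ (List.drop_subset _ _ hx),
          ?_, ?_, ?_⟩
        · intro k j hk hj h
          rw [hgetD k hk, hgetD j hj] at h
          have := hnodup _ _ _ _ h
          omega
        · intro k hk
          rw [hgetD k (by omega), hgetD (k + 1) hk]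
          exact hchain (i + k) (by rw [hlenD] at hk; omega)
        · rw [hheadD, hlastD]
          refine ⟨?_, by linarith, by linarith, by linarith, by linarith⟩
          rcases hl1 with h | h
          · -- the last vertex of `p` would be the earlier occurrence: a short loop, contradiction
            exfalso
            have hidx : p.length - 1 = i := hnodup (p.length - 1) i (by omega) hi (h.trans hia.symm)
            have hil : (p[i]).2 = (p[p.length - 1]).2 := by
              subst hidx; rfl
            linarith
          · rwa [← hia] at h
    · -- APPEND the new vertex
      push Not at hex
      have hlenA : (p ++ [a]).length = p.length + 1 := by
        rw [List.length_append, List.length_singleton]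
      have hAne : p ++ [a] ≠ [] := by simp
      have hgetl : ∀ (k : ℕ) (hk : k < p.length), (p ++ [a])[k]'(by rw [hlenA]; omega) = p[k] :=
        fun k hk => List.getElem_append_left hk
      have hgeta : (p ++ [a])[p.length]'(by rw [hlenA]; omega) = a := by simp
      have hlastA : (p ++ [a]).getLast hAne = a := by simp
      have hheadA : (p ++ [a]).head hAne = p[0] := by
        rw [List.head_eq_getElem]
        exact List.getElem_append_left hlen
      have hrest : rest ≠ [] := by
        intro hr
        subst hr
        simp only [List.getLast_singleton] at hend1
        exact hex 0 hlen hend1.symm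
      obtain ⟨q, hq, hsub, h1, h2, h3⟩ := ih (p ++ [a]) hAne
        (fun k j hk hj h => by
          rw [hlenA] at hk hj
          rcases Nat.lt_succ_iff_lt_or_eq.1 hk with hk' | rfl <;>
            rcases Nat.lt_succ_iff_lt_or_eq.1 hj with hj' | rfl
          · rw [hgetl k hk', hgetl j hj'] at h; exact hnodup k j hk' hj' h
          · rw [hgetl k hk', hgeta] at h; exact absurd h (hex k hk')
          · rw [hgeta, hgetl j hj'] at h; exact absurd h.symm (hex j hj')
          · rfl)
        (fun k hk => by
          rw [hlenA] at hk
          by_cases hk' : k + 1 < p.length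
          · rw [hgetl k (by omega), hgetl (k + 1) hk']; exact hchain k hk'
          · have hk0 : k = p.length - 1 := by omega
            subst hk0
            have e : p.length - 1 + 1 = p.length := by omega
            rw [hgetl (p.length - 1) (by omega)]
            simp only [e, hgeta]
            refine ⟨?_, hl2, hl3⟩
            rcases hl1 with h | h
            · exact absurd h (hex _ _)
            · exact h)
        hw'
        (fun h0 => by
          rw [hlastA]
          obtain ⟨h01, h02, h03⟩ := hw0 h0
          exact ⟨h01, h02, by linarith⟩)
        (fun x hx y hy hxy => hbottle x (hmem_app x hx) y (hmem_app y hy) hxy)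
        (fun x hx => hrange x (hmem_app x hx))
        (by
          rw [List.getLast_cons hrest] at hend1 hend2
          rw [hheadA]
          exact ⟨hrest, hend1, hend2⟩)
      exact ⟨q, hq, fun x hx => hmem_app x (hsub x hx), h1, h2, h3⟩

end Summit.CriticalPhenomena.CardyFormulaZ2.Theorems
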